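import Literature.NumberTheory.LFunctions.WeilCombNodeWeightsTerms
import Mathlib.Analysis.PSeries
import HarnessLib

/-!
# Node weights of `ζ`-mollified combs, V: the constant `β_h` and two counting lemmas

Topic `Literature/NumberTheory/LFunctions`.  Preparations for summing the four ranges of
`Literature/NumberTheory/LFunctions/WeilCombNodeWeightsTerms.lean` over `k' ≤ M`
(`K₀ = ⌊1/(4hnℓ')⌋` closes the sparse range, `K₁ = min(M, ⌊ℓMe^{-2h}/(ℓ'n)⌋)` the dense
interior):

* `toothBeta_nonneg`, `toothBeta_le` — `0 ≤ β_h = ∫ B(v)e^{-hv/2}dv ≤ 8N₀`;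
* `sum_Ioc_inv_sq_le_of_floor` — `∑_{K₀ < k' ≤ M} k'^{-2} ≤ 8hnL`;
* `card_edge_le` — the edge `K₁ < k' ≤ M`, `nℓ'k' ≤ ℓMe^{2h}` has `≤ 8hLM/n + 1` terms;
* `node_ranges`, `node_low_of_lt` — `K₀ ≤ K₁ ≤ M`, `nℓ'K₀ ≤ 1/(4h) ≤ M`, and `K₀ < k'` gives
  `1/(4h) < nℓ'k'`.

Everything is proved; no named facts.
-/

noncomputable section

open MeasureTheory Set

namespace Literature.NumberTheory.LFunctions

/-! ## The constant `β_h` -/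

/-- `β_h = ∫ B(v) e^{-hv/2} dv ≥ 0` for `B ≥ 0`. [folklore] -/
theorem toothBeta_nonneg {B : ℝ → ℝ} (hB0 : ∀ x, 0 ≤ B x) (h : ℝ) :
    0 ≤ ∫ v, B v * Real.exp (-(h * v) / 2) :=
  integral_nonneg fun v ↦ mul_nonneg (hB0 v) (Real.exp_pos _).le

/-- `β_h ≤ 8 N₀` for `0 ≤ B ≤ N₀` supported in `[-2, 2]` and `0 ≤ h ≤ 1/4`. [folklore] -/
theorem toothBeta_le {B : ℝ → ℝ} {N₀ h : ℝ} (hB0 : ∀ x, 0 ≤ B x) (h0 : ∀ x, |B x| ≤ N₀)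
    (hBs : ∀ x, 2 < |x| → B x = 0) (hh : 0 ≤ h) (hh4 : h ≤ 1 / 4) :
    ∫ v, B v * Real.exp (-(h * v) / 2) ≤ 8 * N₀ := by
  have hN₀ : 0 ≤ N₀ := (abs_nonneg _).trans (h0 0)
  have hpt : ∀ v, B v * Real.exp (-(h * v) / 2) ≤ (Icc (-2 : ℝ) 2).indicator (fun _ ↦ 2 * N₀) v := by
    intro v
    by_cases hv : v ∈ Icc (-2 : ℝ) 2
    · rw [indicator_of_mem hv]
      have hexp : Real.exp (-(h * v) / 2) ≤ 2 := by
        have hle : -(h * v) / 2 ≤ h := by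
          have : -v ≤ 2 := by linarith [hv.1]
          nlinarith
        have h1 : Real.exp (-(h * v) / 2) ≤ Real.exp h := Real.exp_le_exp.2 hle
        have hx : |h| ≤ 1 := by rw [abs_of_nonneg hh]; linarith
        have h2 := (abs_le.1 (Real.abs_exp_sub_one_sub_id_le hx)).2
        nlinarith
      have hBv : B v ≤ N₀ := (le_abs_self _).trans (h0 v)
      calc B v * Real.exp (-(h * v) / 2) ≤ N₀ * 2 :=
            mul_le_mul hBv hexp (Real.exp_pos _).le hN₀
        _ = 2 * N₀ := mul_comm _ _
    · rw [indicator_of_notMem hv]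
      have : B v = 0 := by
        apply hBs
        simp only [mem_Icc, not_and_or, not_le] at hv
        rcases hv with hv | hv
        · exact lt_of_lt_of_le (by linarith) (neg_le_abs v)
        · exact lt_of_lt_of_le hv (le_abs_self v)
      rw [this, zero_mul]
  have hint : Integrable ((Icc (-2 : ℝ) 2).indicator fun _ ↦ (2 * N₀ : ℝ)) := by
    rw [integrable_indicator_iff measurableSet_Icc]
    exact integrableOn_const (by rw [Real.volume_Icc]; exact ENNReal.ofReal_ne_top)
  calc ∫ v, B v * Real.exp (-(h * v) / 2)
      ≤ ∫ v, (Icc (-2 : ℝ) 2).indicator (fun _ ↦ (2 * N₀ : ℝ)) v :=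
        integral_mono_of_nonneg (Filter.Eventually.of_forall fun v ↦
          mul_nonneg (hB0 v) (Real.exp_pos _).le) hint (Filter.Eventually.of_forall hpt)
    _ = 8 * N₀ := by
        rw [integral_indicator_const _ measurableSet_Icc, Real.volume_real_Icc_of_le (by norm_num),
          smul_eq_mul]
        ring

/-! ## Two counting lemmas -/

/-- `∑_{K₀ < k' ≤ M} k'^{-2} ≤ 8 h n L` for `K₀ = ⌊1/(4h n ℓ')⌋`, `1 ≤ ℓ' ≤ L`, `n ≥ 1`, `h > 0`:
if `K₀ ≥ 1` the tail is `≤ 1/K₀ ≤ 8hnℓ'`, and if `K₀ = 0` it is `≤ 2 < 8hnℓ'`. [folklore] -/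
theorem sum_Ioc_inv_sq_le_of_floor {h : ℝ} {n ℓ' L M : ℕ} (hh : 0 < h) (hn : 1 ≤ n) (hℓ' : 1 ≤ ℓ')
    (hℓ'L : ℓ' ≤ L) :
    ∑ k' ∈ Finset.Ioc ⌊1 / (4 * h) / ((n : ℝ) * ℓ')⌋₊ M, ((k' : ℝ) ^ 2)⁻¹ ≤ 8 * h * n * L := by
  have hnR : (1 : ℝ) ≤ n := by exact_mod_cast hn
  have hℓ'R : (1 : ℝ) ≤ ℓ' := by exact_mod_cast hℓ'
  have hℓ'LR : (ℓ' : ℝ) ≤ L := by exact_mod_cast hℓ'L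
  have hnl : 0 < (n : ℝ) * ℓ' := by positivity
  set z : ℝ := 1 / (4 * h) / ((n : ℝ) * ℓ') with hz
  have hz0 : 0 ≤ z := by positivity
  have hzinv : 1 / z = 4 * h * n * ℓ' := by rw [hz]; field_simp
  have h8 : 8 * h * n * ℓ' ≤ 8 * h * n * L := by
    have : 0 ≤ 8 * h * n := by positivity
    nlinarith
  set K₀ : ℕ := ⌊z⌋₊ with hK₀
  -- the full tail is at most `2`
  have htail : ∀ K : ℕ, 1 ≤ K → ∑ k' ∈ Finset.Ioc K M, ((k' : ℝ) ^ 2)⁻¹ ≤ (K : ℝ)⁻¹ := by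
    intro K hK
    rcases le_or_gt K M with hKM | hKM
    · have := sum_Ioc_inv_sq_le_sub (α := ℝ) (by omega : K ≠ 0) hKM
      have hM0 : (0 : ℝ) ≤ (M : ℝ)⁻¹ := by positivity
      linarith
    · rw [Finset.Ioc_eq_empty (by omega), Finset.sum_empty]; positivity
  rcases Nat.eq_zero_or_pos K₀ with hK | hK
  · -- `K₀ = 0`: `z < 1`, so `8hnℓ' > 2 ≥ tail`
    rw [hK]
    have hz1 : z < 1 := by
      have := Nat.lt_floor_add_one z; rw [← hK₀, hK] at this; simpa using this
    have hzpos : 0 < z := by rw [hz]; positivity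
    have h2 : 2 < 8 * h * n * ℓ' := by
      have : 1 < 1 / z := by rw [lt_div_iff₀ hzpos]; linarith
      rw [hzinv] at this; linarith
    have hsplit : ∑ k' ∈ Finset.Ioc 0 M, ((k' : ℝ) ^ 2)⁻¹
        ≤ 1 + ∑ k' ∈ Finset.Ioc 1 M, ((k' : ℝ) ^ 2)⁻¹ := by
      rcases Nat.eq_zero_or_pos M with hM | hM
      · rw [hM]; simp
      · rw [← Finset.sum_Ioc_consecutive _ (Nat.zero_le 1) hM]
        simp
    have := htail 1 le_rfl
    simp only [Nat.cast_one, inv_one] at this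
    linarith
  · -- `K₀ ≥ 1`: tail `≤ 1/K₀ ≤ 2/z = 8hnℓ'`
    have hz1 : 1 ≤ z := by
      have : (K₀ : ℝ) ≤ z := Nat.floor_le hz0
      have : (1 : ℝ) ≤ K₀ := by exact_mod_cast hK
      linarith
    have hK₀z : z / 2 ≤ K₀ := by
      have hlt : z < K₀ + 1 := Nat.lt_floor_add_one z
      have h1 : (1 : ℝ) ≤ K₀ := by exact_mod_cast hK
      rcases le_or_gt z 2 with hz2 | hz2
      · linarith
      · linarith
    have hzpos : 0 < z := by linarith
    calc ∑ k' ∈ Finset.Ioc K₀ M, ((k' : ℝ) ^ 2)⁻¹ ≤ (K₀ : ℝ)⁻¹ := htail K₀ hK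
      _ ≤ (z / 2)⁻¹ := by
          rw [inv_le_inv₀ (by positivity) (by positivity)]; exact hK₀z
      _ = 2 * (1 / z) := by field_simp
      _ = 8 * h * n * ℓ' := by rw [hzinv]; ring
      _ ≤ 8 * h * n * L := h8

/-- The edge has few terms: for `K₁ = min M ⌊X₁/n⌋`, `X₁ = ℓ M e^{-2h}/ℓ' ≤ LM`, `0 < h ≤ 1/4`,
`#{K₁ < k' ≤ M : nℓ'k' ≤ ℓ M e^{2h}} ≤ 8hLM/n + 1`. [folklore] -/
theorem card_edge_le {h : ℝ} {n ℓ ℓ' L M : ℕ} (hh : 0 < h) (hh4 : h ≤ 1 / 4) (hn : 1 ≤ n)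
    (hℓ : 1 ≤ ℓ) (hℓL : ℓ ≤ L) (hℓ' : 1 ≤ ℓ') :
    ((((Finset.Ioc (min M ⌊(ℓ : ℝ) * M * Real.exp (-(2 * h)) / (ℓ' * n)⌋₊) M).filter
        (fun k' : ℕ ↦ (n : ℝ) * ℓ' * k' ≤ ℓ * M * Real.exp (2 * h))).card : ℕ) : ℝ)
      ≤ 8 * h * L * M / n + 1 := by
  have hnR : (1 : ℝ) ≤ n := by exact_mod_cast hn
  have hℓR : (1 : ℝ) ≤ ℓ := by exact_mod_cast hℓ
  have hℓLR : (ℓ : ℝ) ≤ L := by exact_mod_cast hℓL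
  have hℓ'R : (1 : ℝ) ≤ ℓ' := by exact_mod_cast hℓ'
  have hn0 : (0 : ℝ) < n := by linarith
  set a : ℝ := (ℓ : ℝ) * M * Real.exp (-(2 * h)) / (ℓ' * n) with ha
  set b : ℝ := (ℓ : ℝ) * M * Real.exp (2 * h) / (ℓ' * n) with hb
  have ha0 : 0 ≤ a := by positivity
  have hb0 : 0 ≤ b := by positivity
  -- the filtered set lies in `Ioc ⌊a⌋ ⌊b⌋`
  have hsub : (Finset.Ioc (min M ⌊a⌋₊) M).filter (fun k' : ℕ ↦ (n : ℝ) * ℓ' * k' ≤ ℓ * M * Real.exp (2 * h))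
      ⊆ Finset.Ioc ⌊a⌋₊ ⌊b⌋₊ := by
    intro k' hk'
    simp only [Finset.mem_filter, Finset.mem_Ioc] at hk'
    obtain ⟨⟨hlo, hhi⟩, hcond⟩ := hk'
    rw [Finset.mem_Ioc]
    constructor
    · rcases le_total M ⌊a⌋₊ with hMa | hMa
      · rw [min_eq_left hMa] at hlo; omega
      · rw [min_eq_right hMa] at hlo; exact hlo
    · apply Nat.le_floor
      rw [hb, le_div_iff₀ (by positivity)]
      linarith
  have hcard := Finset.card_le_card hsub
  rw [Nat.card_Ioc] at hcard
  have hcardR : ((((Finset.Ioc (min M ⌊a⌋₊) M).filter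
      (fun k' : ℕ ↦ (n : ℝ) * ℓ' * k' ≤ ℓ * M * Real.exp (2 * h))).card : ℕ) : ℝ)
      ≤ ((⌊b⌋₊ - ⌊a⌋₊ : ℕ) : ℝ) := by exact_mod_cast hcard
  refine hcardR.trans ?_
  -- `⌊b⌋ - ⌊a⌋ ≤ b - a + 1 ≤ 8hLM/n + 1`
  have hexp4 : Real.exp (2 * h) - Real.exp (-(2 * h)) ≤ 5 * h := by
    have hx : |2 * h| ≤ 1 := by rw [abs_of_pos (by linarith)]; linarith
    have h1 := (abs_le.1 (Real.abs_exp_sub_one_sub_id_le hx)).2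
    have h2 := Real.add_one_le_exp (-(2 * h))
    nlinarith
  have hba : b - a ≤ 8 * h * L * M / n := by
    have hLM : (ℓ : ℝ) * M ≤ L * M := mul_le_mul_of_nonneg_right hℓLR (Nat.cast_nonneg M)
    have hdiff : b - a = (ℓ : ℝ) * M * (Real.exp (2 * h) - Real.exp (-(2 * h))) / (ℓ' * n) := by
      rw [hb, ha]; ring
    have hsub0 : 0 ≤ Real.exp (2 * h) - Real.exp (-(2 * h)) :=
      sub_nonneg.2 (Real.exp_le_exp.2 (by linarith))
    have hnum : (ℓ : ℝ) * M * (Real.exp (2 * h) - Real.exp (-(2 * h))) ≤ L * M * (5 * h) :=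
      mul_le_mul hLM hexp4 hsub0 (by positivity)
    have hL0 : (0 : ℝ) ≤ L := Nat.cast_nonneg L
    calc b - a = _ := hdiff
      _ ≤ L * M * (5 * h) / (ℓ' * n) := div_le_div_of_nonneg_right hnum (by positivity)
      _ ≤ L * M * (5 * h) / n :=
          div_le_div_of_nonneg_left (by positivity) hn0 (le_mul_of_one_le_left hn0.le hℓ'R)
      _ ≤ 8 * h * L * M / n := by
          apply div_le_div_of_nonneg_right _ hn0.le
          nlinarith [mul_nonneg (mul_nonneg hL0 (Nat.cast_nonneg M)) hh.le]
  rcases le_or_gt ⌊a⌋₊ ⌊b⌋₊ with hab | hab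
  · rw [Nat.cast_sub hab]
    have h1 : (⌊b⌋₊ : ℝ) ≤ b := Nat.floor_le hb0
    have h2 : a < ⌊a⌋₊ + 1 := Nat.lt_floor_add_one a
    have : 0 ≤ 8 * h * L * M / (n : ℝ) := by positivity
    linarith
  · rw [Nat.sub_eq_zero_of_le hab.le]
    simp only [Nat.cast_zero]
    positivity

/-! ## The ranges -/

section Ranges

variable {h : ℝ} {n ℓ ℓ' M : ℕ}

/-- Range facts: `K₀ = ⌊1/(4hnℓ')⌋ ≤ K₁ = min(M, ⌊ℓMe^{-2h}/(ℓ'n)⌋) ≤ M` and `K₀ ≤ 1/(4hnℓ')`,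
for `hM ≥ 1`. [folklore] -/
theorem node_ranges (hℓ : 1 ≤ ℓ) (hℓ' : 1 ≤ ℓ') (hn : 1 ≤ n) (hh : 0 < h) (hh4 : h ≤ 1 / 4)
    (hhM : 1 ≤ h * M) :
    ⌊1 / (4 * h) / ((n : ℝ) * ℓ')⌋₊ ≤ min M ⌊(ℓ : ℝ) * M * Real.exp (-(2 * h)) / (ℓ' * n)⌋₊ ∧
      min M ⌊(ℓ : ℝ) * M * Real.exp (-(2 * h)) / (ℓ' * n)⌋₊ ≤ M ∧
      (n : ℝ) * ℓ' * ⌊1 / (4 * h) / ((n : ℝ) * ℓ')⌋₊ ≤ 1 / (4 * h) ∧ 1 / (4 * h) ≤ M := by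
  have hℓR : (1 : ℝ) ≤ ℓ := by exact_mod_cast hℓ
  have hℓ'R : (1 : ℝ) ≤ ℓ' := by exact_mod_cast hℓ'
  have hnR : (1 : ℝ) ≤ n := by exact_mod_cast hn
  have hnl : (1 : ℝ) ≤ (n : ℝ) * ℓ' := by nlinarith
  have hK₀le : (⌊1 / (4 * h) / ((n : ℝ) * ℓ')⌋₊ : ℝ) ≤ 1 / (4 * h) / ((n : ℝ) * ℓ') :=
    Nat.floor_le (by positivity)
  have hYM : 1 / (4 * h) ≤ M := by
    rw [div_le_iff₀ (by positivity)]; nlinarith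
  have h3 : (n : ℝ) * ℓ' * ⌊1 / (4 * h) / ((n : ℝ) * ℓ')⌋₊ ≤ 1 / (4 * h) := by
    have := mul_le_mul_of_nonneg_left hK₀le (by positivity : (0 : ℝ) ≤ (n : ℝ) * ℓ')
    rwa [mul_div_cancel₀ _ (by positivity)] at this
  refine ⟨le_min ?_ ?_, min_le_left _ _, h3, hYM⟩
  · have : (⌊1 / (4 * h) / ((n : ℝ) * ℓ')⌋₊ : ℝ) ≤ M := by
      calc (⌊1 / (4 * h) / ((n : ℝ) * ℓ')⌋₊ : ℝ) ≤ 1 / (4 * h) / ((n : ℝ) * ℓ') := hK₀le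
        _ ≤ 1 / (4 * h) := div_le_self (by positivity) hnl
        _ ≤ M := hYM
    exact_mod_cast this
  · apply Nat.le_floor
    calc (⌊1 / (4 * h) / ((n : ℝ) * ℓ')⌋₊ : ℝ) ≤ 1 / (4 * h) / ((n : ℝ) * ℓ') := hK₀le
      _ ≤ (ℓ : ℝ) * M * Real.exp (-(2 * h)) / (ℓ' * n) := by
          rw [mul_comm (n : ℝ) ℓ']
          apply div_le_div_of_nonneg_right _ (by positivity)
          have he : 1 / 2 ≤ Real.exp (-(2 * h)) := by linarith [Real.add_one_le_exp (-(2 * h))]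
          rw [div_le_iff₀ (by positivity)]
          have : (1 : ℝ) ≤ ℓ * (h * M) * (2 * Real.exp (-(2 * h))) := by
            have h1 : (1 : ℝ) ≤ 2 * Real.exp (-(2 * h)) := by linarith
            calc (1 : ℝ) = 1 * 1 * 1 := by ring
              _ ≤ ℓ * (h * M) * (2 * Real.exp (-(2 * h))) :=
                  mul_le_mul (mul_le_mul hℓR hhM zero_le_one (by linarith)) h1 zero_le_one
                    (by positivity)
          nlinarith

/-- The lower edge of the dense ranges: `K₀ < k'` gives `1/(4h) < nℓ'k'`. [folklore] -/
theorem node_low_of_lt (hℓ' : 1 ≤ ℓ') (hn : 1 ≤ n) {k' : ℕ}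
    (hk' : ⌊1 / (4 * h) / ((n : ℝ) * ℓ')⌋₊ < k') : 1 / (4 * h) < (n : ℝ) * ℓ' * k' := by
  have hℓ'R : (1 : ℝ) ≤ ℓ' := by exact_mod_cast hℓ'
  have hnR : (1 : ℝ) ≤ n := by exact_mod_cast hn
  have h1 : 1 / (4 * h) / ((n : ℝ) * ℓ') < ⌊1 / (4 * h) / ((n : ℝ) * ℓ')⌋₊ + 1 :=
    Nat.lt_floor_add_one _
  have h2 : (⌊1 / (4 * h) / ((n : ℝ) * ℓ')⌋₊ : ℝ) + 1 ≤ k' := by exact_mod_cast hk'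
  have : 1 / (4 * h) / ((n : ℝ) * ℓ') < k' := by linarith
  rw [div_lt_iff₀ (by positivity)] at this
  linarith

end Ranges

end Literature.NumberTheory.LFunctions
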